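/-
Origin: expansion seat `planner-pub-hodgecm-mc-sanity-1-g2-0`, handover #6 2026-08-18T22:03Z md5 98606f2c47a68488995dbbda08dfa0d6 RESTAGED (supersedes 370ff2410ddd of 22:02Z: + `puncture`, `mem_puncture_Theta_iff`, `puncture_goodCtx_iff`, `puncture_open_supply_iff`, `isEmpty_classSupplyData_puncture` — supply is puncture-invariant, the record is destroyed by it; NEW additive leaf, 205 l., 17 decls; #print axioms 7/7 trio; imports HodgeCM.Model.Sanity.ClassSupplySanity (`HOME/mc/pub-hodgecm-mc-sanity-1-g2/lean/ClassSupplyExact.lean`, md5 98606f2c, 205 lines);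
landed by the packager successor (mc-unitary-1-g3, gen-8 kit) in gate run 32 as `HodgeCM/Model/Sanity/ClassSupplyExact.lean` (stripped 7 #print/#check/#eval lines).
-/
import Summits.HodgeConjecture.HodgeCM.Model.Sanity.ClassSupplySanity

/-
Copyright: pub-hodgecm MODEL-CONSTRUCTION cell, 2026-08-18. Seat planner-pub-hodgecm-mc-sanity-1-g2-0 (node SAN-4 (c⁺⁺), second
leaf: the EXACT strength of the class-level supply record, no hypotheses). KERNEL ONLY: 0 records cited, 0 hypotheses minted,
0 proof holes.

# The class-level supply record is EXACTLY "some `Θ_k(Γ)` contains a complex line"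

Intended install path `HodgeCM/Model/Sanity/ClassSupplyExact.lean` (additive leaf; imports `Sanity/ClassSupplySanity.lean` only).

`Sanity/ClassSupplySanity.lean` characterised `Nonempty (P.ClassSupplyData T V c k)` under the hypothesis `hΘ` that
`Θ_k` is scalar-closed.  Here the hypothesis is REMOVED: for EVERY pair datum `P` and EVERY theta model `T`,

  `Nonempty (P.ClassSupplyData T V c k) ↔ ∃ Γ, ∃ ω ≠ 0, ∀ z : ℂ, z • ω ∈ T.Theta V c k Γ`
  (`nonempty_classSupplyData_iff_line`; likewise `nonempty_classSupplyPack_iff_line`),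

i.e. the record is exactly as strong as "some `Θ_k(Γ)` contains a full complex LINE" — in general STRICTLY stronger
than supply `∃ ω ≠ 0 ∈ Θ_k(Γ)` and NOT a function of it: PUNCTURING every `Θ_k(Γ)` at `0` (`T.puncture`) leaves
`Open_supply` unchanged (`puncture_open_supply_iff`) and destroys every class-level record
(`isEmpty_classSupplyData_puncture`, since a record forces `0 ∈ Θ_k(Γ)`, `zero_mem_theta_of_classSupplyData`);
equal to supply for scalar-closed `Θ_k`.  Mechanism (`→`): theta classes are scalar-closed
(`smul_mem_thetaClasses`), so a record for `T` is a record for the LINE-CORE model `T.lineCore`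
(`Θ_k(Γ) ↦ {ω | ℂ ω ⊆ Θ_k(Γ)}`, all other primitives unchanged), whose supply (the owner's KERNEL
`ClassSupplyData.supply`, run on `T.lineCore`) is the line statement; (`←`) is `classSupplyDataOfLine`.
Consequently the hypothesis of `open_supply_of_classSupplyPack` is LITERALLY `T.lineCore.Open_supply`
(`classSupplyPack_hypothesis_iff_lineCore`), with no side condition.
-/

set_option autoImplicit false

noncomputable section

open MeasureTheory NumberField NumberField.mixedEmbedding
open Literature.NumberTheory.Automorphic Literature.NumberTheory.Automorphic.WeightForms
open Literature.NumberTheory.Weil1964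
open HodgeCM.PerL34.SupplyAdelic HodgeCM.Model.SupplyInstance
open scoped SchwartzMap Classical

namespace HodgeCM

/-! ### § 1. The line-core of a theta model -/

namespace Universe.ThetaModel

variable {U : Universe} (T : U.ThetaModel)

/-- The **line-core** of a theta model: same primitives, `Θ_k(Γ)` replaced by the classes whose whole complex line
lies in `Θ_k(Γ)`. -/
def lineCore : U.ThetaModel :=
  { T with Theta := fun V c k Γ => {ω | ∀ z : ℂ, z • ω ∈ T.Theta V c k Γ} }

/-- (Ported verbatim from the HodgeCMPerL package; no docstring in the source.) -/
theorem mem_lineCore_Theta_iff {L : CMField} {ι₁ : L →+* ℂ} (V : HermSpace3 L ι₁) (c : SeesawCtx L) (k : Fin 4)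
    (Γ : Level V) (ω : U.CohC (U.pms L ι₁ V Γ) 1) :
    ω ∈ T.lineCore.Theta V c k Γ ↔ ∀ z : ℂ, z • ω ∈ T.Theta V c k Γ := Iff.rfl

/-- (Ported verbatim from the HodgeCMPerL package; no docstring in the source.) -/
theorem lineCore_Theta_subset {L : CMField} {ι₁ : L →+* ℂ} (V : HermSpace3 L ι₁) (c : SeesawCtx L) (k : Fin 4)
    (Γ : Level V) : T.lineCore.Theta V c k Γ ⊆ T.Theta V c k Γ := fun ω hω => by
  simpa only [one_smul] using (T.mem_lineCore_Theta_iff V c k Γ ω).mp hω 1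

/-- The guards do not see `Θ`: `T.lineCore.GoodCtx ↔ T.GoodCtx` (same `kappa`, `frameSign`). -/
theorem lineCore_goodCtx_iff {L : CMField} (ι₁ : L →+* ℂ) (c : SeesawCtx L) :
    T.lineCore.GoodCtx ι₁ c ↔ T.GoodCtx ι₁ c := by
  constructor
  · rintro ⟨h₁, h₂, h₃, j, hj, hs⟩
    exact ⟨h₁, h₂, h₃, j, hj, hs⟩
  · rintro ⟨h₁, h₂, h₃, j, hj, hs⟩
    exact ⟨h₁, h₂, h₃, j, hj, hs⟩

/-- `Open_supply` of the line-core, unfolded. -/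
theorem lineCore_open_supply_iff :
    T.lineCore.Open_supply ↔
      ∀ {L : CMField} {ι₁ : L →+* ℂ} (V : HermSpace3 L ι₁) (c : SeesawCtx L), T.GoodCtx ι₁ c →
        (∃ Γ : Level V, ∃ ω : U.CohC (U.pms L ι₁ V Γ) 1, (∀ z : ℂ, z • ω ∈ T.Theta V c 0 Γ) ∧ ω ≠ 0) ∧
          ∃ Γ : Level V, ∃ ω : U.CohC (U.pms L ι₁ V Γ) 1, (∀ z : ℂ, z • ω ∈ T.Theta V c 1 Γ) ∧ ω ≠ 0 :=
  ⟨fun h _ ι₁ V c hc => h V c ((T.lineCore_goodCtx_iff ι₁ c).mpr hc),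
    fun h _ ι₁ V c hc => h V c ((T.lineCore_goodCtx_iff ι₁ c).mp hc)⟩

/-- The **punctured** theta model: same primitives, `0` removed from every `Θ_k(Γ)`. -/
def puncture : U.ThetaModel :=
  { T with Theta := fun V c k Γ => T.Theta V c k Γ \ {0} }

/-- (Ported verbatim from the HodgeCMPerL package; no docstring in the source.) -/
theorem mem_puncture_Theta_iff {L : CMField} {ι₁ : L →+* ℂ} (V : HermSpace3 L ι₁) (c : SeesawCtx L) (k : Fin 4)
    (Γ : Level V) (ω : U.CohC (U.pms L ι₁ V Γ) 1) :
    ω ∈ T.puncture.Theta V c k Γ ↔ ω ∈ T.Theta V c k Γ ∧ ω ≠ 0 := Set.mem_sdiff_singleton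

/-- (Ported verbatim from the HodgeCMPerL package; no docstring in the source.) -/
theorem puncture_goodCtx_iff {L : CMField} (ι₁ : L →+* ℂ) (c : SeesawCtx L) :
    T.puncture.GoodCtx ι₁ c ↔ T.GoodCtx ι₁ c := by
  constructor
  · rintro ⟨h₁, h₂, h₃, j, hj, hs⟩
    exact ⟨h₁, h₂, h₃, j, hj, hs⟩
  · rintro ⟨h₁, h₂, h₃, j, hj, hs⟩
    exact ⟨h₁, h₂, h₃, j, hj, hs⟩

/-- **Supply does not see the puncture**: `T.puncture.Open_supply ↔ T.Open_supply`. -/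
theorem puncture_open_supply_iff : T.puncture.Open_supply ↔ T.Open_supply := by
  refine ⟨fun h L ι₁ V c hc => ?_, fun h L ι₁ V c hc => ?_⟩
  · obtain ⟨⟨Γ₀, ω₀, h₀, hne₀⟩, Γ₁, ω₁, h₁, hne₁⟩ := h V c ((T.puncture_goodCtx_iff ι₁ c).mpr hc)
    exact ⟨⟨Γ₀, ω₀, ((T.mem_puncture_Theta_iff V c 0 Γ₀ ω₀).mp h₀).1, hne₀⟩,
      Γ₁, ω₁, ((T.mem_puncture_Theta_iff V c 1 Γ₁ ω₁).mp h₁).1, hne₁⟩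
  · obtain ⟨⟨Γ₀, ω₀, h₀, hne₀⟩, Γ₁, ω₁, h₁, hne₁⟩ := h V c ((T.puncture_goodCtx_iff ι₁ c).mp hc)
    exact ⟨⟨Γ₀, ω₀, (T.mem_puncture_Theta_iff V c 0 Γ₀ ω₀).mpr ⟨h₀, hne₀⟩, hne₀⟩,
      Γ₁, ω₁, (T.mem_puncture_Theta_iff V c 1 Γ₁ ω₁).mpr ⟨h₁, hne₁⟩, hne₁⟩

end Universe.ThetaModel

namespace Model
namespace SupplyResidual

/-! ### § 2. A class-level record for `T` is one for `T.lineCore` -/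

namespace WeilPairData

variable {K L : Type} [Field K] [NumberField K] [Field L] [NumberField L] [Algebra K L] [FiniteDimensional K L]
variable {J : Type} [Fintype J] {GU : Type} [Group GU] [TopologicalSpace GU] [IsTopologicalGroup GU]
  [LocallyCompactSpace GU] (P : WeilPairData K L J GU) [CompactSpace (GU ⧸ P.ΓU)]
variable {U : Universe} (T : U.ThetaModel) {Lc : CMField} {ι₁ : Lc →+* ℂ} (V : HermSpace3 Lc ι₁) (c : SeesawCtx Lc)
  (k : Fin 4)

variable {P T V c k} in
/-- Theta classes are scalar-closed, so `theta_sub` for `T` gives `theta_sub` for `T.lineCore`. -/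
def ClassSupplyData.toLineCore (S : P.ClassSupplyData T V c k) : P.ClassSupplyData T.lineCore V c k :=
  { S with theta_sub := fun _ hh z => S.theta_sub (smul_mem_thetaClasses S.ιinf S.D _ z hh) }

/-- **EXACT strength of the class-level record** (every `P`, every `T`, no hypotheses):
inhabited iff some `Θ_k(Γ)` contains a full complex line. -/
theorem nonempty_classSupplyData_iff_line :
    Nonempty (P.ClassSupplyData T V c k) ↔
      ∃ Γ : Level V, ∃ ω : U.CohC (U.pms Lc ι₁ V Γ) 1, ω ≠ 0 ∧ ∀ z : ℂ, z • ω ∈ T.Theta V c k Γ := by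
  refine ⟨fun ⟨S⟩ => ?_, fun ⟨Γ, ω, hne, hline⟩ => ⟨P.classSupplyDataOfLine T V c k Γ ω hne hline⟩⟩
  obtain ⟨Γ, ω, hω, hne⟩ := S.toLineCore.supply
  exact ⟨Γ, ω, hne, hω⟩

/-- In particular the record is at least as strong as supply, and it FORCES `0 ∈ Θ_k(Γ)` for some `Γ`. -/
theorem zero_mem_theta_of_classSupplyData (S : P.ClassSupplyData T V c k) : ∃ Γ : Level V, (0 : U.CohC (U.pms Lc ι₁ V Γ) 1) ∈ T.Theta V c k Γ := by
  obtain ⟨Γ, ω, -, hline⟩ := (P.nonempty_classSupplyData_iff_line T V c k).mp ⟨S⟩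
  exact ⟨Γ, by simpa only [zero_smul] using hline 0⟩

/-- **… while the class-level record is destroyed by the puncture**: no `ClassSupplyData` over `T.puncture`, for
any `P`.  With `puncture_open_supply_iff`: the record is NOT a function of supply. -/
theorem isEmpty_classSupplyData_puncture : IsEmpty (P.ClassSupplyData T.puncture V c k) :=
  ⟨fun S => by
    obtain ⟨Γ, h0⟩ := P.zero_mem_theta_of_classSupplyData T.puncture V c k S
    exact ((T.mem_puncture_Theta_iff V c k Γ 0).mp h0).2 rfl⟩

end WeilPairData

/-! ### § 3. The pack, and the hypothesis of `open_supply_of_classSupplyPack` -/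

section Pack

variable {U : Universe} (T : U.ThetaModel) {Lc : CMField} {ι₁ : Lc →+* ℂ} (V : HermSpace3 Lc ι₁) (c : SeesawCtx Lc)
  (k : Fin 4)

/-- **EXACT strength of the class supply pack** (given one archimedean test function non-vanishing at a rational
point, for the `←` carriers). -/
theorem nonempty_classSupplyPack_iff_line {K : Type} [Field K] [NumberField K] {J : Type} [Fintype J]
    (Φinf : 𝓢((J → mixedSpace K), ℂ)) (x₀ : J → K) (hx₀ : Φinf (archEmb K J x₀) ≠ 0) :
    Nonempty (ClassSupplyPack T V c k) ↔
      ∃ Γ : Level V, ∃ ω : U.CohC (U.pms Lc ι₁ V Γ) 1, ω ≠ 0 ∧ ∀ z : ℂ, z • ω ∈ T.Theta V c k Γ := by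
  refine ⟨fun ⟨S⟩ => ?_, fun ⟨Γ, ω, hne, hline⟩ => ⟨classSupplyPackOfLine T V c k Φinf x₀ hx₀ Γ ω hne hline⟩⟩
  obtain ⟨Γ, ω, hω, hne⟩ := S.cls.toLineCore.supply
  exact ⟨Γ, ω, hne, hω⟩

variable {T V c k} in
/-- A class supply pack for `T` is one for `T.lineCore` (same carriers and pair data). -/
def ClassSupplyPack.toLineCore (S : ClassSupplyPack T V c k) : ClassSupplyPack T.lineCore V c k :=
  { S with cls := S.cls.toLineCore }

/-- **The hypothesis of `open_supply_of_classSupplyPack` is LITERALLY `T.lineCore.Open_supply`** — no side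
condition (`→`: run the owner's kernel theorem on the line-core; `←`: `classSupplyPackOfLine`). -/
theorem classSupplyPack_hypothesis_iff_lineCore {K : Type} [Field K] [NumberField K] {J : Type} [Fintype J]
    (Φinf : 𝓢((J → mixedSpace K), ℂ)) (x₀ : J → K) (hx₀ : Φinf (archEmb K J x₀) ≠ 0) :
    (∀ {Lc : CMField} {ι₁ : Lc →+* ℂ} (V : HermSpace3 Lc ι₁) (c : SeesawCtx Lc), T.GoodCtx ι₁ c →
        Nonempty (ClassSupplyPack T V c 0) ∧ Nonempty (ClassSupplyPack T V c 1)) ↔ T.lineCore.Open_supply := by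
  refine ⟨fun H => open_supply_of_classSupplyPack T.lineCore fun V c hc =>
      ⟨(H V c ((T.lineCore_goodCtx_iff _ c).mp hc)).1.map ClassSupplyPack.toLineCore,
        (H V c ((T.lineCore_goodCtx_iff _ c).mp hc)).2.map ClassSupplyPack.toLineCore⟩,
    fun H Lc ι₁ V c hc => ?_⟩
  obtain ⟨⟨Γ₀, ω₀, h₀, hne₀⟩, Γ₁, ω₁, h₁, hne₁⟩ := H V c ((T.lineCore_goodCtx_iff ι₁ c).mpr hc)
  exact ⟨⟨classSupplyPackOfLine T V c 0 Φinf x₀ hx₀ Γ₀ ω₀ hne₀ h₀⟩,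
    ⟨classSupplyPackOfLine T V c 1 Φinf x₀ hx₀ Γ₁ ω₁ hne₁ h₁⟩⟩

/-- Hence `open_supply_of_classSupplyPack` factors through the line-core: it proves `T.lineCore.Open_supply`, which
implies `T.Open_supply` (`lineCore_Theta_subset`). -/
theorem open_supply_of_lineCore_open_supply (h : T.lineCore.Open_supply) : T.Open_supply := fun V c hc => by
  obtain ⟨⟨Γ₀, ω₀, h₀, hne₀⟩, Γ₁, ω₁, h₁, hne₁⟩ := h V c ((T.lineCore_goodCtx_iff _ c).mpr hc)
  exact ⟨⟨Γ₀, ω₀, T.lineCore_Theta_subset V c 0 Γ₀ h₀, hne₀⟩, Γ₁, ω₁, T.lineCore_Theta_subset V c 1 Γ₁ h₁, hne₁⟩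

end Pack

end SupplyResidual
end Model
end HodgeCM

end

/-! ## Axiom audit (expected: `propext`, `Classical.choice`, `Quot.sound` only) -/
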